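import Summits.AtomisticToContinuum.Crystallization.Theorems.ExcessDecayLiouvilleCaccioppoli

/-!
# Route `ExcessDecayLiouville`: the quantitative Caccioppoli bound

Companion of `ExcessDecayLiouvilleCaccioppoli.lean` (step (c1) of the energy route for item `ExcessDecay`,
stmt-AtomisticToContinuum-9334).  For a finitely supported displacement `h` on the sites of an admissible
datum and a cutoff `η` of slope `1/ρ` (`|η p − η q| ≤ |p − q|/ρ` on the sites), the right-hand side of the
Caccioppoli identity is controlled by the `ℓ²` norm of `h`:

`|½ Σ'Σ' [p≠q] (η_p − η_q)² ⟪K(p−q) h_p, h_q⟫| ≤ (19·C₆/ρ²) Σ'_p ‖h p‖²`,  `C₆ = 1024/(23/25)⁶`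

(`abs_cutoffForm_le`; termwise `(η_p−η_q)²|K| ≤ 38|p−q|⁻⁶/ρ²`, then `|h_p||h_q| ≤ (|h_p|²+|h_q|²)/2`, Fubini
for the nonnegative double family and the lattice sum `Σ_{q≠p} |p−q|⁻⁶ ≤ C₆`).  Combined with
`caccioppoli_inequality`: `κ·nnForm(η•h) ≤ (19·C₆/ρ²)·Σ' ‖h p‖²` for `L h = 0` on `supp η`
(`caccioppoli_l2`).  All `[folklore]`; helper lemmas, nothing here closes an item.
-/

noncomputable section

namespace Summit.AtomisticToContinuum.Crystallization.Theorems.ExcessDecayLiouville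

open scoped BigOperators Topology InnerProductSpace RealInnerProductSpace
open Literature.MathematicalPhysics.StatisticalMechanics
open Summit.AtomisticToContinuum.Crystallization.Theorems.PhononStabilityNegative

section

variable {t : Fin 2 → (EuclideanSpace ℝ (Fin 3))} {A : (EuclideanSpace ℝ (Fin 3)) →L[ℝ] (EuclideanSpace ℝ (Fin 3))}

/-- `Σ'_{q ≠ p} |p − q|⁻⁶ ≤ 1024/(23/25)⁶` over the sites, for a site `p` (as a `tsum` bound). [folklore] -/
theorem tsum_inv_pow_six_sites_le (hA : Adm₀ A) (hI : Inner₀ t A) {p : (EuclideanSpace ℝ (Fin 3))} (hp : p ∈ Sites₀ t A) :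
    ∑' q : Sites₀ t A, (if (q : (EuclideanSpace ℝ (Fin 3))) ≠ p then (dist (q : (EuclideanSpace ℝ (Fin 3))) p)⁻¹ ^ 6 else 0) ≤
      1024 / ((23 / 25 : ℝ) ^ 3 * (23 / 25 : ℝ) ^ 3) := by
  classical
  refine Real.tsum_le_of_sum_le (fun q => by split_ifs <;> positivity) fun u => ?_
  have hsum : ∑ q ∈ u, (if (q : (EuclideanSpace ℝ (Fin 3))) ≠ p then (dist (q : (EuclideanSpace ℝ (Fin 3))) p)⁻¹ ^ 6 else 0) =
      ∑ a ∈ (u.map (Function.Embedding.subtype _)).filter (· ≠ p), (dist a p)⁻¹ ^ (3 + 3) := by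
    rw [Finset.sum_filter, Finset.sum_map]
    rfl
  rw [hsum]
  refine sum_inv_pow_le_of_separated _ p (by norm_num) (by norm_num) le_rfl ?_ ?_
  · intro a ha b hb hab
    simp only [Finset.mem_filter, Finset.mem_map, Function.Embedding.coe_subtype] at ha hb
    obtain ⟨⟨a', -, rfl⟩, -⟩ := ha
    obtain ⟨⟨b', -, rfl⟩, -⟩ := hb
    exact dist_sites_ge hA hI a'.2 b'.2 hab
  · intro a ha
    simp only [Finset.mem_filter, Finset.mem_map, Function.Embedding.coe_subtype] at ha
    obtain ⟨⟨a', -, rfl⟩, ha2⟩ := ha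
    exact dist_sites_ge hA hI a'.2 hp ha2

/-- The weighted family `(p,q) ↦ [p≠q] |p−q|⁻⁶ ‖h q‖²` is summable on `S × S` and its double sum is
`≤ C₆ Σ' ‖h q‖²` (finitely supported `h`). [folklore] -/
theorem summable_weightFamily (hA : Adm₀ A) (hI : Inner₀ t A) {h : (EuclideanSpace ℝ (Fin 3)) → (EuclideanSpace ℝ (Fin 3))}
    (hh : (Function.support h).Finite) :
    Summable (fun pq : Sites₀ t A × Sites₀ t A =>
      if (pq.1 : (EuclideanSpace ℝ (Fin 3))) ≠ pq.2 then (dist (pq.1 : (EuclideanSpace ℝ (Fin 3))) pq.2)⁻¹ ^ 6 * ‖h pq.2‖ ^ 2 else 0) := by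
  classical
  -- summable over (q, p) ordering first: rows q with h q ≠ 0 only
  have hsw : Summable (fun qp : Sites₀ t A × Sites₀ t A =>
      if (qp.2 : (EuclideanSpace ℝ (Fin 3))) ≠ qp.1 then (dist (qp.2 : (EuclideanSpace ℝ (Fin 3))) qp.1)⁻¹ ^ 6 * ‖h qp.1‖ ^ 2 else 0) := by
    rw [summable_prod_of_nonneg (fun qp => by simp only; split_ifs <;> positivity)]
    constructor
    · intro q
      have h6 : Summable (fun p : Sites₀ t A => if (p : (EuclideanSpace ℝ (Fin 3))) ≠ q then (dist (p : (EuclideanSpace ℝ (Fin 3))) q)⁻¹ ^ 6 else 0) := by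
        refine summable_of_sum_le (fun p => by split_ifs <;> positivity)
          (c := 1024 / ((23 / 25 : ℝ) ^ 3 * (23 / 25 : ℝ) ^ 3)) fun u => ?_
        have hsum : ∑ p ∈ u, (if (p : (EuclideanSpace ℝ (Fin 3))) ≠ q then (dist (p : (EuclideanSpace ℝ (Fin 3))) q)⁻¹ ^ 6 else 0) =
            ∑ a ∈ (u.map (Function.Embedding.subtype _)).filter (· ≠ (q : (EuclideanSpace ℝ (Fin 3)))), (dist a q)⁻¹ ^ (3 + 3) := by
          rw [Finset.sum_filter, Finset.sum_map]
          rfl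
        rw [hsum]
        refine sum_inv_pow_le_of_separated _ (q : (EuclideanSpace ℝ (Fin 3))) (by norm_num) (by norm_num) le_rfl ?_ ?_
        · intro a ha b hb hab
          simp only [Finset.mem_filter, Finset.mem_map, Function.Embedding.coe_subtype] at ha hb
          obtain ⟨⟨a', -, rfl⟩, -⟩ := ha
          obtain ⟨⟨b', -, rfl⟩, -⟩ := hb
          exact dist_sites_ge hA hI a'.2 b'.2 hab
        · intro a ha
          simp only [Finset.mem_filter, Finset.mem_map, Function.Embedding.coe_subtype] at ha
          obtain ⟨⟨a', -, rfl⟩, ha2⟩ := ha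
          exact dist_sites_ge hA hI a'.2 q.2 ha2
      refine (h6.mul_right (‖h q‖ ^ 2)).congr fun p => ?_
      by_cases hpq : (p : (EuclideanSpace ℝ (Fin 3))) = q
      · simp [hpq]
      · have : (p : (EuclideanSpace ℝ (Fin 3))) ≠ q := hpq
        simp [this]
    · refine summable_of_ne_finset_zero (s := (finite_support_sites (t := t) (A := A) hh).toFinset) ?_
      intro q hq
      have hvq : h q = 0 := by
        by_contra h'
        exact hq ((Set.Finite.mem_toFinset _).2 h')
      simp [hvq]
  -- swap back
  have := hsw.prod_symm
  refine this.congr fun pq => ?_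
  obtain ⟨p, q⟩ := pq
  simp only [Prod.swap_prod_mk]

/-- **The cutoff form is controlled by the `ℓ²` norm**: for finitely supported `h` and a cutoff of
slope `1/ρ` on the sites, `|½ Σ'Σ' [p≠q] (η_p−η_q)² ⟪K(p−q)h_p, h_q⟫| ≤ (19·C₆/ρ²) Σ'_p ‖h p‖²`. [folklore] -/
theorem abs_cutoffForm_le (hA : Adm₀ A) (hI : Inner₀ t A) {h : (EuclideanSpace ℝ (Fin 3)) → (EuclideanSpace ℝ (Fin 3))}
    (hh : (Function.support h).Finite) {η : (EuclideanSpace ℝ (Fin 3)) → ℝ} {ρ : ℝ} (hρ : 0 < ρ)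
    (hlip : ∀ p q : Sites₀ t A, |η p - η q| ≤ ‖(p : (EuclideanSpace ℝ (Fin 3))) - q‖ / ρ) :
    |(1 / 2 : ℝ) * ∑' p : Sites₀ t A, ∑' q : Sites₀ t A, (if (p : (EuclideanSpace ℝ (Fin 3))) ≠ q then (η p - η q) ^ 2 * ⟪((-((‖(p : (EuclideanSpace ℝ (Fin 3))) - q‖ ^ 2)⁻¹) ^ 7 + ((‖(p : (EuclideanSpace ℝ (Fin 3))) - q‖ ^ 2)⁻¹) ^ 4) • (h p) + (2 * ⟪(p : (EuclideanSpace ℝ (Fin 3))) - q, h p⟫ * (7 * ((‖(p : (EuclideanSpace ℝ (Fin 3))) - q‖ ^ 2)⁻¹) ^ 8 - 4 * ((‖(p : (EuclideanSpace ℝ (Fin 3))) - q‖ ^ 2)⁻¹) ^ 5)) • ((p : (EuclideanSpace ℝ (Fin 3))) - q)), h q⟫ else 0)| ≤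
      19 * (1024 / ((23 / 25 : ℝ) ^ 3 * (23 / 25 : ℝ) ^ 3)) / ρ ^ 2 * ∑' p : Sites₀ t A, ‖h p‖ ^ 2 := by
  classical
  -- the nonnegative majorant W(p,q) = [p≠q] (19/ρ²)|p−q|⁻⁶ (‖h p‖² + ‖h q‖²)
  have hW1 := summable_weightFamily hA hI hh
  have hWau : Summable (Function.uncurry fun (p q : Sites₀ t A) => (if (p : (EuclideanSpace ℝ (Fin 3))) ≠ q then (dist (p : (EuclideanSpace ℝ (Fin 3))) q)⁻¹ ^ 6 * ‖h q‖ ^ 2 else 0)) := hW1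
  have hW2s : Summable (Function.uncurry fun (p q : Sites₀ t A) => (if (q : (EuclideanSpace ℝ (Fin 3))) ≠ p then (dist (q : (EuclideanSpace ℝ (Fin 3))) p)⁻¹ ^ 6 * ‖h p‖ ^ 2 else 0)) := by
    refine hW1.prod_symm.congr fun pq => ?_
    obtain ⟨p, q⟩ := pq
    simp only [Prod.swap_prod_mk, Function.uncurry_apply_pair]
  -- termwise bound
  have hterm : ∀ p q : Sites₀ t A, |(if (p : (EuclideanSpace ℝ (Fin 3))) ≠ q then (η p - η q) ^ 2 * ⟪((-((‖(p : (EuclideanSpace ℝ (Fin 3))) - q‖ ^ 2)⁻¹) ^ 7 + ((‖(p : (EuclideanSpace ℝ (Fin 3))) - q‖ ^ 2)⁻¹) ^ 4) • (h p) + (2 * ⟪(p : (EuclideanSpace ℝ (Fin 3))) - q, h p⟫ * (7 * ((‖(p : (EuclideanSpace ℝ (Fin 3))) - q‖ ^ 2)⁻¹) ^ 8 - 4 * ((‖(p : (EuclideanSpace ℝ (Fin 3))) - q‖ ^ 2)⁻¹) ^ 5)) • ((p : (EuclideanSpace ℝ (Fin 3))) - q)), h q⟫ else 0)| ≤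
      19 / ρ ^ 2 * ((if (p : (EuclideanSpace ℝ (Fin 3))) ≠ q then (dist (p : (EuclideanSpace ℝ (Fin 3))) q)⁻¹ ^ 6 * ‖h q‖ ^ 2 else 0) +
        (if (q : (EuclideanSpace ℝ (Fin 3))) ≠ p then (dist (q : (EuclideanSpace ℝ (Fin 3))) p)⁻¹ ^ 6 * ‖h p‖ ^ 2 else 0)) := by
    intro p q
    by_cases hpq : (p : (EuclideanSpace ℝ (Fin 3))) = q
    · simp [hpq]
    · have hqp : (q : (EuclideanSpace ℝ (Fin 3))) ≠ p := fun h' => hpq h'.symm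
      rw [if_pos hpq, if_pos hpq, if_pos hqp, abs_mul, abs_pow, sq_abs]
      have hd : (23 / 25 : ℝ) ≤ dist (p : (EuclideanSpace ℝ (Fin 3))) q := dist_sites_ge hA hI p.2 q.2 hpq
      have he : 9 / 10 ≤ ‖(p : (EuclideanSpace ℝ (Fin 3))) - q‖ := by rw [← dist_eq_norm]; linarith
      have hdpos : 0 < dist (p : (EuclideanSpace ℝ (Fin 3))) q := by linarith
      have hin : |⟪((-((‖(p : (EuclideanSpace ℝ (Fin 3))) - q‖ ^ 2)⁻¹) ^ 7 + ((‖(p : (EuclideanSpace ℝ (Fin 3))) - q‖ ^ 2)⁻¹) ^ 4) • (h p) + (2 * ⟪(p : (EuclideanSpace ℝ (Fin 3))) - q, h p⟫ * (7 * ((‖(p : (EuclideanSpace ℝ (Fin 3))) - q‖ ^ 2)⁻¹) ^ 8 - 4 * ((‖(p : (EuclideanSpace ℝ (Fin 3))) - q‖ ^ 2)⁻¹) ^ 5)) • ((p : (EuclideanSpace ℝ (Fin 3))) - q)), h q⟫| ≤ 38 * (‖(p : (EuclideanSpace ℝ (Fin 3))) - q‖⁻¹) ^ 8 * ‖h p‖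 * ‖h q‖ :=
        (abs_real_inner_le_norm _ _).trans (mul_le_mul_of_nonneg_right (norm_forceConst_apply_le he _) (norm_nonneg _))
      have hηsq : (η p - η q) ^ 2 ≤ ‖(p : (EuclideanSpace ℝ (Fin 3))) - q‖ ^ 2 / ρ ^ 2 := by
        have h1 := hlip p q
        have h0 : 0 ≤ ‖(p : (EuclideanSpace ℝ (Fin 3))) - q‖ / ρ := by positivity
        calc (η p - η q) ^ 2 = |η p - η q| ^ 2 := (sq_abs _).symm
          _ ≤ (‖(p : (EuclideanSpace ℝ (Fin 3))) - q‖ / ρ) ^ 2 := pow_le_pow_left₀ (abs_nonneg _) h1 2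
          _ = ‖(p : (EuclideanSpace ℝ (Fin 3))) - q‖ ^ 2 / ρ ^ 2 := by rw [div_pow]
      set d := dist (p : (EuclideanSpace ℝ (Fin 3))) q with hdd
      have hnd : ‖(p : (EuclideanSpace ℝ (Fin 3))) - q‖ = d := by rw [hdd, dist_eq_norm]
      rw [hnd] at hin hηsq
      rw [dist_comm (q : (EuclideanSpace ℝ (Fin 3))) p, ← hdd]
      have hd6 : (d⁻¹) ^ 8 * d ^ 2 = (d⁻¹) ^ 6 := by field_simp
      have hprod : (η p - η q) ^ 2 * |⟪((-((‖(p : (EuclideanSpace ℝ (Fin 3))) - q‖ ^ 2)⁻¹) ^ 7 + ((‖(p : (EuclideanSpace ℝ (Fin 3))) - q‖ ^ 2)⁻¹) ^ 4) • (h p) + (2 * ⟪(p : (EuclideanSpace ℝ (Fin 3))) - q, h p⟫ * (7 * ((‖(p : (EuclideanSpace ℝ (Fin 3))) - q‖ ^ 2)⁻¹) ^ 8 - 4 * ((‖(p : (EuclideanSpace ℝ (Fin 3))) - q‖ ^ 2)⁻¹) ^ 5)) • ((p : (EuclideanSpace ℝ (Fin 3))) - q)), h q⟫| ≤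
          (d ^ 2 / ρ ^ 2) * (38 * (d⁻¹) ^ 8 * ‖h p‖ * ‖h q‖) :=
        mul_le_mul hηsq hin (abs_nonneg _) (by positivity)
      have hamgm : ‖h p‖ * ‖h q‖ ≤ (‖h p‖ ^ 2 + ‖h q‖ ^ 2) / 2 := by nlinarith [sq_nonneg (‖h p‖ - ‖h q‖)]
      have h6pos : 0 ≤ (d⁻¹) ^ 6 := by positivity
      calc (η p - η q) ^ 2 * |⟪((-((‖(p : (EuclideanSpace ℝ (Fin 3))) - q‖ ^ 2)⁻¹) ^ 7 + ((‖(p : (EuclideanSpace ℝ (Fin 3))) - q‖ ^ 2)⁻¹) ^ 4) • (h p) + (2 * ⟪(p : (EuclideanSpace ℝ (Fin 3))) - q, h p⟫ * (7 * ((‖(p : (EuclideanSpace ℝ (Fin 3))) - q‖ ^ 2)⁻¹) ^ 8 - 4 * ((‖(p : (EuclideanSpace ℝ (Fin 3))) - q‖ ^ 2)⁻¹) ^ 5)) • ((p : (EuclideanSpace ℝ (Fin 3))) - q)), h q⟫|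
          ≤ (d ^ 2 / ρ ^ 2) * (38 * (d⁻¹) ^ 8 * ‖h p‖ * ‖h q‖) := hprod
        _ = 38 / ρ ^ 2 * ((d⁻¹) ^ 8 * d ^ 2) * (‖h p‖ * ‖h q‖) := by ring
        _ = 38 / ρ ^ 2 * (d⁻¹) ^ 6 * (‖h p‖ * ‖h q‖) := by rw [hd6]
        _ ≤ 38 / ρ ^ 2 * (d⁻¹) ^ 6 * ((‖h p‖ ^ 2 + ‖h q‖ ^ 2) / 2) := by gcongr
        _ = 19 / ρ ^ 2 * ((d⁻¹) ^ 6 * ‖h q‖ ^ 2 + (d⁻¹) ^ 6 * ‖h p‖ ^ 2) := by ring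
  -- sum the majorant
  have hmaj : Summable (Function.uncurry fun (p q : Sites₀ t A) => (19 / ρ ^ 2 * ((if (p : (EuclideanSpace ℝ (Fin 3))) ≠ q then (dist (p : (EuclideanSpace ℝ (Fin 3))) q)⁻¹ ^ 6 * ‖h q‖ ^ 2 else 0) + (if (q : (EuclideanSpace ℝ (Fin 3))) ≠ p then (dist (q : (EuclideanSpace ℝ (Fin 3))) p)⁻¹ ^ 6 * ‖h p‖ ^ 2 else 0)))) := by
    have := (hWau.add hW2s).mul_left (19 / ρ ^ 2)
    refine this.congr fun pq => ?_
    obtain ⟨p, q⟩ := pq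
    simp only [Function.uncurry_apply_pair]
  have hXs : Summable (Function.uncurry fun (p q : Sites₀ t A) => (if (p : (EuclideanSpace ℝ (Fin 3))) ≠ q then (η p - η q) ^ 2 * ⟪((-((‖(p : (EuclideanSpace ℝ (Fin 3))) - q‖ ^ 2)⁻¹) ^ 7 + ((‖(p : (EuclideanSpace ℝ (Fin 3))) - q‖ ^ 2)⁻¹) ^ 4) • (h p) + (2 * ⟪(p : (EuclideanSpace ℝ (Fin 3))) - q, h p⟫ * (7 * ((‖(p : (EuclideanSpace ℝ (Fin 3))) - q‖ ^ 2)⁻¹) ^ 8 - 4 * ((‖(p : (EuclideanSpace ℝ (Fin 3))) - q‖ ^ 2)⁻¹) ^ 5)) • ((p : (EuclideanSpace ℝ (Fin 3))) - q)), h q⟫ else 0)) := by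
    refine Summable.of_norm_bounded hmaj fun pq => ?_
    obtain ⟨p, q⟩ := pq
    rw [Real.norm_eq_abs]
    exact hterm p q
  -- ‖Σ'Σ' Ξ‖ ≤ Σ'Σ' M
  have hrowle : ∀ p : Sites₀ t A, ‖∑' q : Sites₀ t A, (if (p : (EuclideanSpace ℝ (Fin 3))) ≠ q then (η p - η q) ^ 2 * ⟪((-((‖(p : (EuclideanSpace ℝ (Fin 3))) - q‖ ^ 2)⁻¹) ^ 7 + ((‖(p : (EuclideanSpace ℝ (Fin 3))) - q‖ ^ 2)⁻¹) ^ 4) • (h p) + (2 * ⟪(p : (EuclideanSpace ℝ (Fin 3))) - q, h p⟫ * (7 * ((‖(p : (EuclideanSpace ℝ (Fin 3))) - q‖ ^ 2)⁻¹) ^ 8 - 4 * ((‖(p : (EuclideanSpace ℝ (Fin 3))) - q‖ ^ 2)⁻¹) ^ 5)) • ((p : (EuclideanSpace ℝ (Fin 3))) - q)), h q⟫ else 0)‖ ≤ ∑' q : Sites₀ t A, (19 / ρ ^ 2 * ((if (p : (EuclideanSpace ℝ (Fin 3))) ≠ q then (dist (p : (EuclideanSpace ℝ (Fin 3))) q)⁻¹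 ^ 6 * ‖h q‖ ^ 2 else 0) + (if (q : (EuclideanSpace ℝ (Fin 3))) ≠ p then (dist (q : (EuclideanSpace ℝ (Fin 3))) p)⁻¹ ^ 6 * ‖h p‖ ^ 2 else 0))) := by
    intro p
    have hr : Summable (fun q : Sites₀ t A => (if (p : (EuclideanSpace ℝ (Fin 3))) ≠ q then (η p - η q) ^ 2 * ⟪((-((‖(p : (EuclideanSpace ℝ (Fin 3))) - q‖ ^ 2)⁻¹) ^ 7 + ((‖(p : (EuclideanSpace ℝ (Fin 3))) - q‖ ^ 2)⁻¹) ^ 4) • (h p) + (2 * ⟪(p : (EuclideanSpace ℝ (Fin 3))) - q, h p⟫ * (7 * ((‖(p : (EuclideanSpace ℝ (Fin 3))) - q‖ ^ 2)⁻¹) ^ 8 - 4 * ((‖(p : (EuclideanSpace ℝ (Fin 3))) - q‖ ^ 2)⁻¹) ^ 5)) • ((p : (EuclideanSpace ℝ (Fin 3))) - q)), h q⟫ else 0)) := hXs.prod_factor p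
    have hm : Summable (fun q : Sites₀ t A => (19 / ρ ^ 2 * ((if (p : (EuclideanSpace ℝ (Fin 3))) ≠ q then (dist (p : (EuclideanSpace ℝ (Fin 3))) q)⁻¹ ^ 6 * ‖h q‖ ^ 2 else 0) + (if (q : (EuclideanSpace ℝ (Fin 3))) ≠ p then (dist (q : (EuclideanSpace ℝ (Fin 3))) p)⁻¹ ^ 6 * ‖h p‖ ^ 2 else 0)))) := hmaj.prod_factor p
    refine (norm_tsum_le_tsum_norm hr.norm).trans (hr.norm.tsum_le_tsum (fun q => ?_) hm)
    rw [Real.norm_eq_abs]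
    exact hterm p q
  have hout : Summable (fun p : Sites₀ t A => ∑' q : Sites₀ t A, (if (p : (EuclideanSpace ℝ (Fin 3))) ≠ q then (η p - η q) ^ 2 * ⟪((-((‖(p : (EuclideanSpace ℝ (Fin 3))) - q‖ ^ 2)⁻¹) ^ 7 + ((‖(p : (EuclideanSpace ℝ (Fin 3))) - q‖ ^ 2)⁻¹) ^ 4) • (h p) + (2 * ⟪(p : (EuclideanSpace ℝ (Fin 3))) - q, h p⟫ * (7 * ((‖(p : (EuclideanSpace ℝ (Fin 3))) - q‖ ^ 2)⁻¹) ^ 8 - 4 * ((‖(p : (EuclideanSpace ℝ (Fin 3))) - q‖ ^ 2)⁻¹) ^ 5)) • ((p : (EuclideanSpace ℝ (Fin 3))) - q)), h q⟫ else 0)) := hXs.prod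
  have houtM : Summable (fun p : Sites₀ t A => ∑' q : Sites₀ t A, (19 / ρ ^ 2 * ((if (p : (EuclideanSpace ℝ (Fin 3))) ≠ q then (dist (p : (EuclideanSpace ℝ (Fin 3))) q)⁻¹ ^ 6 * ‖h q‖ ^ 2 else 0) + (if (q : (EuclideanSpace ℝ (Fin 3))) ≠ p then (dist (q : (EuclideanSpace ℝ (Fin 3))) p)⁻¹ ^ 6 * ‖h p‖ ^ 2 else 0)))) := hmaj.prod
  have h1 : ‖∑' p : Sites₀ t A, ∑' q : Sites₀ t A, (if (p : (EuclideanSpace ℝ (Fin 3))) ≠ q then (η p - η q) ^ 2 * ⟪((-((‖(p : (EuclideanSpace ℝ (Fin 3))) - q‖ ^ 2)⁻¹) ^ 7 + ((‖(p : (EuclideanSpace ℝ (Fin 3))) - q‖ ^ 2)⁻¹) ^ 4) • (h p) + (2 * ⟪(p : (EuclideanSpace ℝ (Fin 3))) - q, h p⟫ * (7 * ((‖(p : (EuclideanSpace ℝ (Fin 3))) - q‖ ^ 2)⁻¹) ^ 8 - 4 * ((‖(p : (EuclideanSpace ℝ (Fin 3))) - q‖ ^ 2)⁻¹) ^ 5))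 • ((p : (EuclideanSpace ℝ (Fin 3))) - q)), h q⟫ else 0)‖ ≤ ∑' p : Sites₀ t A, ∑' q : Sites₀ t A, (19 / ρ ^ 2 * ((if (p : (EuclideanSpace ℝ (Fin 3))) ≠ q then (dist (p : (EuclideanSpace ℝ (Fin 3))) q)⁻¹ ^ 6 * ‖h q‖ ^ 2 else 0) + (if (q : (EuclideanSpace ℝ (Fin 3))) ≠ p then (dist (q : (EuclideanSpace ℝ (Fin 3))) p)⁻¹ ^ 6 * ‖h p‖ ^ 2 else 0))) :=
    (norm_tsum_le_tsum_norm hout.norm).trans (hout.norm.tsum_le_tsum hrowle houtM)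
  -- evaluate / bound Σ'Σ' M
  have hh2 : Summable (fun p : Sites₀ t A => ‖h p‖ ^ 2) := by
    refine summable_of_ne_finset_zero (s := (finite_support_sites (t := t) (A := A) hh).toFinset) ?_
    intro p hp
    have hvp : h p = 0 := by
      by_contra h'
      exact hp ((Set.Finite.mem_toFinset _).2 h')
    simp [hvp]
  have hC6 : ∀ p : Sites₀ t A, (∑' q : Sites₀ t A, (if (q : (EuclideanSpace ℝ (Fin 3))) ≠ p then (dist (q : (EuclideanSpace ℝ (Fin 3))) p)⁻¹ ^ 6 else 0)) ≤ (1024 / ((23 / 25 : ℝ) ^ 3 * (23 / 25 : ℝ) ^ 3)) :=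
    fun p => tsum_inv_pow_six_sites_le hA hI p.2
  -- the Wb part
  have hWb_row : ∀ p : Sites₀ t A, (∑' q : Sites₀ t A, (if (q : (EuclideanSpace ℝ (Fin 3))) ≠ p then (dist (q : (EuclideanSpace ℝ (Fin 3))) p)⁻¹ ^ 6 * ‖h p‖ ^ 2 else 0)) ≤ (1024 / ((23 / 25 : ℝ) ^ 3 * (23 / 25 : ℝ) ^ 3)) * ‖h p‖ ^ 2 := by
    intro p
    have : (∑' q : Sites₀ t A, (if (q : (EuclideanSpace ℝ (Fin 3))) ≠ p then (dist (q : (EuclideanSpace ℝ (Fin 3))) p)⁻¹ ^ 6 * ‖h p‖ ^ 2 else 0)) =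
        (∑' q : Sites₀ t A, (if (q : (EuclideanSpace ℝ (Fin 3))) ≠ p then (dist (q : (EuclideanSpace ℝ (Fin 3))) p)⁻¹ ^ 6 else 0)) * ‖h p‖ ^ 2 := by
      rw [← tsum_mul_right]
      refine tsum_congr fun q => ?_
      split_ifs <;> simp
    rw [this]
    exact mul_le_mul_of_nonneg_right (hC6 p) (sq_nonneg _)
  have hWb : (∑' p : Sites₀ t A, ∑' q : Sites₀ t A, (if (q : (EuclideanSpace ℝ (Fin 3))) ≠ p then (dist (q : (EuclideanSpace ℝ (Fin 3))) p)⁻¹ ^ 6 * ‖h p‖ ^ 2 else 0)) ≤ (1024 / ((23 / 25 : ℝ) ^ 3 * (23 / 25 : ℝ) ^ 3)) * ∑' p : Sites₀ t A, ‖h p‖ ^ 2 := by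
    rw [← tsum_mul_left]
    have hWb_out : Summable (fun p : Sites₀ t A => ∑' q : Sites₀ t A, (if (q : (EuclideanSpace ℝ (Fin 3))) ≠ p then (dist (q : (EuclideanSpace ℝ (Fin 3))) p)⁻¹ ^ 6 * ‖h p‖ ^ 2 else 0)) := hW2s.prod
    exact hWb_out.tsum_le_tsum hWb_row (hh2.mul_left _)
  -- the Wa part (swap the order of summation first)
  have hWa_comm : (∑' p : Sites₀ t A, ∑' q : Sites₀ t A, (if (p : (EuclideanSpace ℝ (Fin 3))) ≠ q then (dist (p : (EuclideanSpace ℝ (Fin 3))) q)⁻¹ ^ 6 * ‖h q‖ ^ 2 else 0)) =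
      ∑' q : Sites₀ t A, ∑' p : Sites₀ t A, (if (p : (EuclideanSpace ℝ (Fin 3))) ≠ q then (dist (p : (EuclideanSpace ℝ (Fin 3))) q)⁻¹ ^ 6 * ‖h q‖ ^ 2 else 0) := (hWau.tsum_comm).symm
  have hWa_row : ∀ q : Sites₀ t A, (∑' p : Sites₀ t A, (if (p : (EuclideanSpace ℝ (Fin 3))) ≠ q then (dist (p : (EuclideanSpace ℝ (Fin 3))) q)⁻¹ ^ 6 * ‖h q‖ ^ 2 else 0)) ≤ (1024 / ((23 / 25 : ℝ) ^ 3 * (23 / 25 : ℝ) ^ 3)) * ‖h q‖ ^ 2 := by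
    intro q
    have : (∑' p : Sites₀ t A, (if (p : (EuclideanSpace ℝ (Fin 3))) ≠ q then (dist (p : (EuclideanSpace ℝ (Fin 3))) q)⁻¹ ^ 6 * ‖h q‖ ^ 2 else 0)) =
        (∑' p : Sites₀ t A, (if (p : (EuclideanSpace ℝ (Fin 3))) ≠ q then (dist (p : (EuclideanSpace ℝ (Fin 3))) q)⁻¹ ^ 6 else 0)) * ‖h q‖ ^ 2 := by
      rw [← tsum_mul_right]
      refine tsum_congr fun p => ?_
      split_ifs <;> simp
    rw [this]
    exact mul_le_mul_of_nonneg_right (hC6 q) (sq_nonneg _)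
  have hWa : (∑' p : Sites₀ t A, ∑' q : Sites₀ t A, (if (p : (EuclideanSpace ℝ (Fin 3))) ≠ q then (dist (p : (EuclideanSpace ℝ (Fin 3))) q)⁻¹ ^ 6 * ‖h q‖ ^ 2 else 0)) ≤ (1024 / ((23 / 25 : ℝ) ^ 3 * (23 / 25 : ℝ) ^ 3)) * ∑' q : Sites₀ t A, ‖h q‖ ^ 2 := by
    rw [hWa_comm, ← tsum_mul_left]
    have hWa_out' : Summable (fun q : Sites₀ t A => ∑' p : Sites₀ t A, (if (p : (EuclideanSpace ℝ (Fin 3))) ≠ q then (dist (p : (EuclideanSpace ℝ (Fin 3))) q)⁻¹ ^ 6 * ‖h q‖ ^ 2 else 0)) := hWau.prod_symm.prod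
    exact hWa_out'.tsum_le_tsum hWa_row (hh2.mul_left _)
  have hMsum : (∑' p : Sites₀ t A, ∑' q : Sites₀ t A, (19 / ρ ^ 2 * ((if (p : (EuclideanSpace ℝ (Fin 3))) ≠ q then (dist (p : (EuclideanSpace ℝ (Fin 3))) q)⁻¹ ^ 6 * ‖h q‖ ^ 2 else 0) + (if (q : (EuclideanSpace ℝ (Fin 3))) ≠ p then (dist (q : (EuclideanSpace ℝ (Fin 3))) p)⁻¹ ^ 6 * ‖h p‖ ^ 2 else 0)))) =
      19 / ρ ^ 2 * ((∑' p : Sites₀ t A, ∑' q : Sites₀ t A, (if (p : (EuclideanSpace ℝ (Fin 3))) ≠ q then (dist (p : (EuclideanSpace ℝ (Fin 3))) q)⁻¹ ^ 6 * ‖h q‖ ^ 2 else 0)) +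
        ∑' p : Sites₀ t A, ∑' q : Sites₀ t A, (if (q : (EuclideanSpace ℝ (Fin 3))) ≠ p then (dist (q : (EuclideanSpace ℝ (Fin 3))) p)⁻¹ ^ 6 * ‖h p‖ ^ 2 else 0)) := by
    have hWa_out : Summable (fun p : Sites₀ t A => ∑' q : Sites₀ t A, (if (p : (EuclideanSpace ℝ (Fin 3))) ≠ q then (dist (p : (EuclideanSpace ℝ (Fin 3))) q)⁻¹ ^ 6 * ‖h q‖ ^ 2 else 0)) := hWau.prod
    have hWb_out : Summable (fun p : Sites₀ t A => ∑' q : Sites₀ t A, (if (q : (EuclideanSpace ℝ (Fin 3))) ≠ p then (dist (q : (EuclideanSpace ℝ (Fin 3))) p)⁻¹ ^ 6 * ‖h p‖ ^ 2 else 0)) := hW2s.prod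
    have hWa_r : ∀ p : Sites₀ t A, Summable (fun q : Sites₀ t A => (if (p : (EuclideanSpace ℝ (Fin 3))) ≠ q then (dist (p : (EuclideanSpace ℝ (Fin 3))) q)⁻¹ ^ 6 * ‖h q‖ ^ 2 else 0)) := fun p => hWau.prod_factor p
    have hWb_r : ∀ p : Sites₀ t A, Summable (fun q : Sites₀ t A => (if (q : (EuclideanSpace ℝ (Fin 3))) ≠ p then (dist (q : (EuclideanSpace ℝ (Fin 3))) p)⁻¹ ^ 6 * ‖h p‖ ^ 2 else 0)) := fun p => hW2s.prod_factor p
    rw [← hWa_out.tsum_add hWb_out, ← tsum_mul_left]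
    refine tsum_congr fun p => ?_
    rw [← (hWa_r p).tsum_add (hWb_r p), ← tsum_mul_left]
  -- conclude
  have hρ2 : 0 < ρ ^ 2 := by positivity
  have hS0 : 0 ≤ ∑' p : Sites₀ t A, ‖h p‖ ^ 2 := tsum_nonneg fun _ => sq_nonneg _
  rw [abs_mul, abs_of_pos (by norm_num : (0 : ℝ) < 1 / 2), ← Real.norm_eq_abs]
  have h2 : ∑' p : Sites₀ t A, ∑' q : Sites₀ t A, (19 / ρ ^ 2 * ((if (p : (EuclideanSpace ℝ (Fin 3))) ≠ q then (dist (p : (EuclideanSpace ℝ (Fin 3))) q)⁻¹ ^ 6 * ‖h q‖ ^ 2 else 0) + (if (q : (EuclideanSpace ℝ (Fin 3))) ≠ p then (dist (q : (EuclideanSpace ℝ (Fin 3))) p)⁻¹ ^ 6 * ‖h p‖ ^ 2 else 0))) ≤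
      19 / ρ ^ 2 * ((1024 / ((23 / 25 : ℝ) ^ 3 * (23 / 25 : ℝ) ^ 3)) * (∑' p : Sites₀ t A, ‖h p‖ ^ 2) + (1024 / ((23 / 25 : ℝ) ^ 3 * (23 / 25 : ℝ) ^ 3)) * ∑' p : Sites₀ t A, ‖h p‖ ^ 2) := by
    rw [hMsum]
    exact mul_le_mul_of_nonneg_left (add_le_add hWa hWb) (by positivity)
  have h3 := h1.trans h2
  have : 19 / ρ ^ 2 * ((1024 / ((23 / 25 : ℝ) ^ 3 * (23 / 25 : ℝ) ^ 3)) * (∑' p : Sites₀ t A, ‖h p‖ ^ 2) + (1024 / ((23 / 25 : ℝ) ^ 3 * (23 / 25 : ℝ) ^ 3)) * ∑' p : Sites₀ t A, ‖h p‖ ^ 2) =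
      2 * (19 * (1024 / ((23 / 25 : ℝ) ^ 3 * (23 / 25 : ℝ) ^ 3)) / ρ ^ 2 * ∑' p : Sites₀ t A, ‖h p‖ ^ 2) := by ring
  rw [this] at h3
  linarith

/-- **Caccioppoli inequality, `ℓ²` form.**  With the coercivity constant `κ` of `coercive_of_phononStability`,
a finitely supported displacement `h`, a finitely supported cutoff `η` on the sites of slope `1/ρ`, and
`(L h)(p) = 0` wherever `η p ≠ 0`:  `κ · nnForm t A (η • h) ≤ (19·C₆/ρ²) Σ'_p ‖h p‖²`. [folklore] -/
theorem caccioppoli_l2 (hA : Adm₀ A) (hI : Inner₀ t A) {κ : ℝ}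
    (hκ : ∀ v : (EuclideanSpace ℝ (Fin 3)) → (EuclideanSpace ℝ (Fin 3)), (Function.support v).Finite → Function.support v ⊆ Sites₀ t A →
      κ * nnForm t A v ≤ ∑' p : Sites₀ t A, ⟪∑' q : Sites₀ t A,
        (if (p : (EuclideanSpace ℝ (Fin 3))) ≠ q then ((-((‖(p : (EuclideanSpace ℝ (Fin 3))) - q‖ ^ 2)⁻¹) ^ 7 + ((‖(p : (EuclideanSpace ℝ (Fin 3))) - q‖ ^ 2)⁻¹) ^ 4) • (v p - v q) + (2 * ⟪(p : (EuclideanSpace ℝ (Fin 3))) - q, v p - v q⟫ * (7 * ((‖(p : (EuclideanSpace ℝ (Fin 3))) - q‖ ^ 2)⁻¹) ^ 8 - 4 * ((‖(p : (EuclideanSpace ℝ (Fin 3))) - q‖ ^ 2)⁻¹) ^ 5)) • ((p : (EuclideanSpace ℝ (Fin 3))) - q)) else 0), v p⟫)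
    {h : (EuclideanSpace ℝ (Fin 3)) → (EuclideanSpace ℝ (Fin 3))} (hh : (Function.support h).Finite)
    {η : (EuclideanSpace ℝ (Fin 3)) → ℝ} (hη : (Function.support η).Finite) (hηS : Function.support η ⊆ Sites₀ t A)
    {ρ : ℝ} (hρ : 0 < ρ) (hlip : ∀ p q : Sites₀ t A, |η p - η q| ≤ ‖(p : (EuclideanSpace ℝ (Fin 3))) - q‖ / ρ)
    (hharm : ∀ p : Sites₀ t A, η p ≠ 0 → (∑' q : Sites₀ t A, (if (p : (EuclideanSpace ℝ (Fin 3))) ≠ q then ((-((‖(p : (EuclideanSpace ℝ (Fin 3))) - q‖ ^ 2)⁻¹) ^ 7 + ((‖(p : (EuclideanSpace ℝ (Fin 3))) - q‖ ^ 2)⁻¹) ^ 4) • (h p - h q) + (2 * ⟪(p : (EuclideanSpace ℝ (Fin 3))) - q, h p - h q⟫ * (7 * ((‖(p : (EuclideanSpace ℝ (Fin 3))) - q‖ ^ 2)⁻¹) ^ 8 - 4 * ((‖(p : (EuclideanSpace ℝ (Fin 3))) - q‖ ^ 2)⁻¹) ^ 5)) • ((p : (EuclideanSpace ℝ (Fin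 3))) - q)) else 0)) = 0) :
    κ * nnForm t A (fun x => η x • h x) ≤
      19 * (1024 / ((23 / 25 : ℝ) ^ 3 * (23 / 25 : ℝ) ^ 3)) / ρ ^ 2 * ∑' p : Sites₀ t A, ‖h p‖ ^ 2 := by
  obtain ⟨B, -, hB⟩ := exists_bound_of_finite_support hh
  have h1 := caccioppoli_inequality hA hI hκ hB hη hηS hharm
  have h2 := abs_cutoffForm_le hA hI hh hρ hlip (η := η)
  exact h1.trans ((le_abs_self _).trans h2)

/-- **Caccioppoli inequality, inhomogeneous `ℓ²` form**: for finitely supported `h`, a finitely supported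
cutoff `η` on the sites of slope `1/ρ`,
`κ · nnForm t A (η • h) ≤ Σ'_p η_p² ⟪(L h)(p), h_p⟫ + (19·C₆/ρ²) Σ'_p ‖h p‖²`. [folklore] -/
theorem caccioppoli_l2_inhomogeneous (hA : Adm₀ A) (hI : Inner₀ t A) {κ : ℝ}
    (hκ : ∀ v : (EuclideanSpace ℝ (Fin 3)) → (EuclideanSpace ℝ (Fin 3)), (Function.support v).Finite → Function.support v ⊆ Sites₀ t A →
      κ * nnForm t A v ≤ ∑' p : Sites₀ t A, ⟪∑' q : Sites₀ t A,
        (if (p : (EuclideanSpace ℝ (Fin 3))) ≠ q then ((-((‖(p : (EuclideanSpace ℝ (Fin 3))) - q‖ ^ 2)⁻¹) ^ 7 + ((‖(p : (EuclideanSpace ℝ (Fin 3))) - q‖ ^ 2)⁻¹) ^ 4) • (v p - v q) + (2 * ⟪(p : (EuclideanSpace ℝ (Fin 3))) - q, v p - v q⟫ * (7 * ((‖(p : (EuclideanSpace ℝ (Fin 3))) - q‖ ^ 2)⁻¹) ^ 8 - 4 * ((‖(p : (EuclideanSpace ℝ (Fin 3))) - q‖ ^ 2)⁻¹) ^ 5))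 • ((p : (EuclideanSpace ℝ (Fin 3))) - q)) else 0), v p⟫)
    {h : (EuclideanSpace ℝ (Fin 3)) → (EuclideanSpace ℝ (Fin 3))} (hh : (Function.support h).Finite)
    {η : (EuclideanSpace ℝ (Fin 3)) → ℝ} (hη : (Function.support η).Finite) (hηS : Function.support η ⊆ Sites₀ t A)
    {ρ : ℝ} (hρ : 0 < ρ) (hlip : ∀ p q : Sites₀ t A, |η p - η q| ≤ ‖(p : (EuclideanSpace ℝ (Fin 3))) - q‖ / ρ) :
    κ * nnForm t A (fun x => η x • h x) ≤
      (∑' p : Sites₀ t A, (η p) ^ 2 * ⟪∑' q : Sites₀ t A, (if (p : (EuclideanSpace ℝ (Fin 3))) ≠ q then ((-((‖(p : (EuclideanSpace ℝ (Fin 3))) - q‖ ^ 2)⁻¹) ^ 7 + ((‖(p : (EuclideanSpace ℝ (Fin 3))) - q‖ ^ 2)⁻¹) ^ 4) • (h p - h q) + (2 * ⟪(p : (EuclideanSpace ℝ (Fin 3))) - q, h p - h q⟫ * (7 * ((‖(p : (EuclideanSpace ℝ (Fin 3))) - q‖ ^ 2)⁻¹) ^ 8 - 4 * ((‖(p : (EuclideanSpace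 ℝ (Fin 3))) - q‖ ^ 2)⁻¹) ^ 5)) • ((p : (EuclideanSpace ℝ (Fin 3))) - q)) else 0), h p⟫) +
      19 * (1024 / ((23 / 25 : ℝ) ^ 3 * (23 / 25 : ℝ) ^ 3)) / ρ ^ 2 * ∑' p : Sites₀ t A, ‖h p‖ ^ 2 := by
  obtain ⟨B, -, hB⟩ := exists_bound_of_finite_support hh
  have h1 := caccioppoli_inhomogeneous hA hI hκ hB hη hηS
  have h2 := abs_cutoffForm_le hA hI hh hρ hlip (η := η)
  linarith [h1, (le_abs_self _).trans h2]

end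

end Summit.AtomisticToContinuum.Crystallization.Theorems.ExcessDecayLiouville

end
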